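import Summits.CriticalPhenomena.PercolationContinuityZ3.Theorems.FK.LocalEventInterlacing
import Summits.CriticalPhenomena.PercolationContinuityZ3.Theorems.FK.TwoPointFunctionTailFK
import HarnessLib

/-!
# FK-continuity cell, FO-10a: `p ↦ φ⁰_{p,q}` is left-continuous with right limits `φ¹_{p,q}`, and `p ↦ φ¹_{p,q}` is
# right-continuous with left limits `φ⁰_{p,q}`, in the LOCAL (weak) topology; `𝒟_q` is exactly the set of discontinuities
# (Grimmett 2006, Prop. (4.28)(b)(c) and Thm. (4.63), assembled for ALL local events by inclusion–exclusion)

Registered R82 (cell INBOX l.5940, 2026-08-24); registry row FO-10a-g337p; label PCT-E (coordinator fk-4 g175).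
Cell `fk-continuity` (bschramm), row FO-10a (domain-Markov + comparison layer over FO-06); support file for the
FK-continuity transplant (`--supports stmt-CriticalPhenomena-4575`); builds on p205010 (kernel theorem, internal audit
signed; external expert review pending). Pure proofs; no definitions, no named facts, no sorries; general `d ≥ 1`.

`LocalEventInterlacing.lean` gives, for every INCREASING local event `A`, `φ⁰_{t,q}(A) → φ¹_{p,q}(A)` as `t ↓ p` and
`φ¹_{t,q}(A) → φ⁰_{p,q}(A)` as `t ↑ p` (with the one-sided continuity of row FO-10a-g335s). Here the same for EVERY local event:
a local event is a finite disjoint union of cylinders `C(F, S) = {ω ∩ F = S}`, and a cylinder probability is an alternating sum of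
probabilities of the increasing cylinders `{E₀ ⊆ ω}` — the filter-general transfer lemmas of `TwoPointFunctionTailFK.lean` (FO-08),
imported and used by name.

* (tools, REUSED BY NAME from FO-08's `TwoPointFunctionTailFK.lean`: `tendsto_measureReal_cylEvent_of_tendsto_supset` /
  `tendsto_measureReal_of_isLocalEvent_of_tendsto_supset` — along any filter, convergence on the increasing cylinders `{E₀ ⊆ ω}` to the
  values of a measure `ν` ⇒ convergence on every cylinder / local event to `ν`'s value);
* **`tendsto_rcLimit_false_real_nhdsGT_of_isLocalEvent`** — `φ⁰_{t,q}(A) → φ¹_{p,q}(A)` as `t ↓ p` for EVERY local event `A`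
  (`0 ≤ p < 1`): **the right limit of `p ↦ φ⁰_{p,q}` in the local topology is `φ¹_{p,q}`**;
  **`tendsto_rcLimit_true_real_nhdsLT_of_isLocalEvent`** — `φ¹_{t,q}(A) → φ⁰_{p,q}(A)` as `t ↑ p` (`0 < p ≤ 1`);
  `tendsto_rcLimit_false_real_nhdsLT_of_isLocalEvent` (φ⁰ left-continuous), `tendsto_rcLimit_true_real_nhdsGT_of_isLocalEvent` (φ¹ right-continuous);
* HEADLINE **`rcLimit_false_eq_rcLimit_true_iff_forall_isLocalEvent_continuousAt (hd : 0 < d) (hp : p ∈ Ioo 0 1) (hq : 1 ≤ q) :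
  φ⁰_{p,q} = φ¹_{p,q} ↔ ∀ A, IsLocalEvent A → ContinuousAt (fun t => (rcLimit d false t q).real A) p`** — `𝒟_q` is exactly the set of
  `p ∈ (0,1)` at which the measure-valued map `p ↦ φ⁰_{p,q}` (equivalently `p ↦ φ¹_{p,q}`, `…_true`) is discontinuous in the local topology.

Honest framing: UNCONDITIONAL structure; NOT a binder discharge, NOT `_r4`; `_r3` « 2 / 0 ☑ », n_open = 2 unchanged.

## References

* G. Grimmett, *The Random-Cluster Model*, Springer 2006 (`book:grimmett2006-random-cluster-model`): §4.1 (cylinders, local events),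
  Prop. (4.28) [PDF p. 80], Thm. (4.63) and eqs (4.73)–(4.78) [PDF pp. 89, 92–93]. [Grimmett2006]
-/

noncomputable section

open MeasureTheory Set Filter
open scoped Topology ENNReal

namespace Summit.CriticalPhenomena.PercolationContinuityZ3.Theorems.FK

open Literature.Probability.Percolation Literature.Probability.LatticeModels

/-! ### One-sided limits of `p ↦ φ^b_{p,q}` on every local event -/

section RandomCluster

variable {d : ℕ} {p q : ℝ} {A : Set (BondConfig (Site d))}

/-- The increasing cylinder `{E₀ ⊆ ω}` is an increasing local event. [folklore] -/
theorem isUpperSet_setOf_subset_and_determinedBy (E₀ : Finset (Sym2 (Site d))) :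
    IsUpperSet {ω : BondConfig (Site d) | (↑E₀ : Set (Sym2 (Site d))) ⊆ ω} ∧
      DeterminedBy {ω : BondConfig (Site d) | (↑E₀ : Set (Sym2 (Site d))) ⊆ ω} ↑E₀ := by
  refine ⟨fun ω ω' hle hω => Set.Subset.trans hω hle, (determinedBy_iff _ _).2 fun ω ω' h => ?_⟩
  simp only [Set.mem_setOf_eq]
  constructor
  · intro hω e he
    have : e ∈ ω ∩ ↑E₀ := ⟨hω he, he⟩
    rw [h] at this
    exact this.1
  · intro hω e he
    have : e ∈ ω' ∩ ↑E₀ := ⟨hω he, he⟩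
    rw [← h] at this
    exact this.1

/-- **The right limit of `p ↦ φ⁰_{p,q}` is `φ¹_{p,q}` in the local topology**: `φ⁰_{t,q}(A) → φ¹_{p,q}(A)` as `t ↓ p` for EVERY
local event `A` (`d ≥ 1`, `0 ≤ p < 1`, `q ≥ 1`). [cite: Grimmett2006, Thm. (4.63) (proof, (4.77)–(4.78)) with Prop. (4.28)(b) and §4.1] -/
theorem tendsto_rcLimit_false_real_nhdsGT_of_isLocalEvent (hd : 0 < d) (hq : 1 ≤ q) (hA : IsLocalEvent A)
    (hp : p ∈ Set.Ico (0 : ℝ) 1) :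
    Tendsto (fun t : ℝ => (rcLimit d false t q).real A) (𝓝[>] p) (𝓝 ((rcLimit d true p q).real A)) := by
  haveI : ∀ t : ℝ, IsFiniteMeasure (rcLimit d false t q) := fun t => by
    haveI := isProbabilityMeasure_rcLimit false t q (d := d); infer_instance
  haveI := isProbabilityMeasure_rcLimit true p q (d := d)
  refine tendsto_measureReal_of_isLocalEvent_of_tendsto_supset _ _ (fun E₀ => ?_) hA
  obtain ⟨hU, hD⟩ := isUpperSet_setOf_subset_and_determinedBy (d := d) E₀
  exact tendsto_rcLimit_false_real_nhdsGT_of_determinedBy hd hq hD hU hp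

/-- **The left limit of `p ↦ φ¹_{p,q}` is `φ⁰_{p,q}` in the local topology**: `φ¹_{t,q}(A) → φ⁰_{p,q}(A)` as `t ↑ p` for EVERY
local event `A` (`0 < p ≤ 1`, `q ≥ 1`). [cite: Grimmett2006, Thm. (4.63) (proof, (4.77)–(4.78)) with Prop. (4.28)(c) and §4.1] -/
theorem tendsto_rcLimit_true_real_nhdsLT_of_isLocalEvent (hq : 1 ≤ q) (hA : IsLocalEvent A)
    (hp : p ∈ Set.Ioc (0 : ℝ) 1) :
    Tendsto (fun t : ℝ => (rcLimit d true t q).real A) (𝓝[<] p) (𝓝 ((rcLimit d false p q).real A)) := by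
  haveI : ∀ t : ℝ, IsFiniteMeasure (rcLimit d true t q) := fun t => by
    haveI := isProbabilityMeasure_rcLimit true t q (d := d); infer_instance
  haveI := isProbabilityMeasure_rcLimit false p q (d := d)
  refine tendsto_measureReal_of_isLocalEvent_of_tendsto_supset _ _ (fun E₀ => ?_) hA
  obtain ⟨hU, hD⟩ := isUpperSet_setOf_subset_and_determinedBy (d := d) E₀
  exact tendsto_rcLimit_true_real_nhdsLT_of_determinedBy hq hD hU hp

/-- **`p ↦ φ⁰_{p,q}` is left-continuous in the local topology** (`0 < p ≤ 1`, `q ≥ 1`). [cite: Grimmett2006, Prop. (4.28)(c) and §4.1] -/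
theorem tendsto_rcLimit_false_real_nhdsLT_of_isLocalEvent (hq : 1 ≤ q) (hA : IsLocalEvent A)
    (hp : p ∈ Set.Ioc (0 : ℝ) 1) :
    Tendsto (fun t : ℝ => (rcLimit d false t q).real A) (𝓝[<] p) (𝓝 ((rcLimit d false p q).real A)) := by
  haveI : ∀ t : ℝ, IsFiniteMeasure (rcLimit d false t q) := fun t => by
    haveI := isProbabilityMeasure_rcLimit false t q (d := d); infer_instance
  haveI := isProbabilityMeasure_rcLimit false p q (d := d)
  refine tendsto_measureReal_of_isLocalEvent_of_tendsto_supset _ _ (fun E₀ => ?_) hA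
  obtain ⟨hU, hD⟩ := isUpperSet_setOf_subset_and_determinedBy (d := d) E₀
  exact tendsto_rcLimit_false_real_nhdsLT hq hD hU hp

/-- **`p ↦ φ¹_{p,q}` is right-continuous in the local topology** (`d ≥ 1`, `0 ≤ p < 1`, `q ≥ 1`). [cite: Grimmett2006, Prop. (4.28)(b) and §4.1] -/
theorem tendsto_rcLimit_true_real_nhdsGT_of_isLocalEvent (hd : 0 < d) (hq : 1 ≤ q) (hA : IsLocalEvent A)
    (hp : p ∈ Set.Ico (0 : ℝ) 1) :
    Tendsto (fun t : ℝ => (rcLimit d true t q).real A) (𝓝[>] p) (𝓝 ((rcLimit d true p q).real A)) := by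
  haveI : ∀ t : ℝ, IsFiniteMeasure (rcLimit d true t q) := fun t => by
    haveI := isProbabilityMeasure_rcLimit true t q (d := d); infer_instance
  haveI := isProbabilityMeasure_rcLimit true p q (d := d)
  refine tendsto_measureReal_of_isLocalEvent_of_tendsto_supset _ _ (fun E₀ => ?_) hA
  obtain ⟨hU, hD⟩ := isUpperSet_setOf_subset_and_determinedBy (d := d) E₀
  exact tendsto_rcLimit_true_real_nhdsGT hd hq hD hU hp

/-- **`𝒟_q` is the discontinuity set of `p ↦ φ⁰_{p,q}` in the local topology**: for `p ∈ (0,1)`, `φ⁰_{p,q} = φ¹_{p,q}` iff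
`t ↦ φ⁰_{t,q}(A)` is continuous at `p` for EVERY local event `A` (`d ≥ 1`, `q ≥ 1`). [cite: Grimmett2006, Thm. (4.63) with Prop. (4.28) and §4.1] -/
theorem rcLimit_false_eq_rcLimit_true_iff_forall_isLocalEvent_continuousAt (hd : 0 < d) (hp : p ∈ Set.Ioo (0 : ℝ) 1)
    (hq : 1 ≤ q) :
    rcLimit d false p q = rcLimit d true p q ↔
      ∀ A : Set (BondConfig (Site d)), IsLocalEvent A → ContinuousAt (fun t : ℝ => (rcLimit d false t q).real A) p := by
  constructor
  · intro h A hA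
    rw [continuousAt_iff_continuous_left'_right']
    refine ⟨tendsto_rcLimit_false_real_nhdsLT_of_isLocalEvent hq hA ⟨hp.1, hp.2.le⟩, ?_⟩
    have hr := tendsto_rcLimit_false_real_nhdsGT_of_isLocalEvent hd hq hA ⟨hp.1.le, hp.2⟩
    rw [← h] at hr
    exact hr
  · intro h
    exact (rcLimit_false_eq_rcLimit_true_iff_forall_continuousAt hd hp hq).2 fun A F hAu hA => h A ⟨F, hA⟩

/-- The same for the wired measure: `φ⁰_{p,q} = φ¹_{p,q}` iff `t ↦ φ¹_{t,q}(A)` is continuous at `p` for every local event `A`.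
[cite: Grimmett2006, Thm. (4.63) with Prop. (4.28) and §4.1] -/
theorem rcLimit_false_eq_rcLimit_true_iff_forall_isLocalEvent_continuousAt_true (hd : 0 < d) (hp : p ∈ Set.Ioo (0 : ℝ) 1)
    (hq : 1 ≤ q) :
    rcLimit d false p q = rcLimit d true p q ↔
      ∀ A : Set (BondConfig (Site d)), IsLocalEvent A → ContinuousAt (fun t : ℝ => (rcLimit d true t q).real A) p := by
  constructor
  · intro h A hA
    rw [continuousAt_iff_continuous_left'_right']
    refine ⟨?_, tendsto_rcLimit_true_real_nhdsGT_of_isLocalEvent hd hq hA ⟨hp.1.le, hp.2⟩⟩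
    have hl := tendsto_rcLimit_true_real_nhdsLT_of_isLocalEvent hq hA ⟨hp.1, hp.2.le⟩
    rw [h] at hl
    exact hl
  · intro h
    -- the edge event is local; continuity of `φ¹(e open)` at `p` forces `h⁰(e) = h¹(e)`
    set y₀ : Site d := (0 : Site d) + Pi.single (⟨0, hd⟩ : Fin d) 1 with hy₀
    have hxy : (zdGraph d).Adj (0 : Site d) y₀ := (zdGraph_adj_iff _ _).2 ⟨⟨0, hd⟩, Or.inl rfl⟩
    obtain ⟨hAu, hA⟩ := isUpperSet_setOf_mem_and_determinedBy (d := d) s((0 : Site d), y₀)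
    by_contra hne
    exact not_continuousAt_rcLimit_real_setOf_mem_of_ne hp hq hne hxy true (h _ ⟨_, hA⟩)

end RandomCluster

end Summit.CriticalPhenomena.PercolationContinuityZ3.Theorems.FK

end
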